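import Mathlib
import HarnessLib
import Literature.MathematicalPhysics.StatisticalMechanics.HigherDerivativeForms

/-!
# Commuting lattice derivatives and the one-dimensional discrete Sobolev inequality
# (towards Adams–Buchholz–Kotecký–Müller Lemma 7.9)

[ABKM19] Lemma 7.8 (Theorem 7.1 (w9)) rests on the discrete Sobolev inequality Lemma 7.9
("Sobolev already considered such inequalities on lattices … a similar claim with `d` derivatives
appeared in [BGM04, Prop. B2] and [BS15I, Lemma 6.6]").  For the line's weights the mixed-derivative
form suffices (the order `M` of the higher-derivative operators is at our disposal), and it follows by
iterating a ONE-DIMENSIONAL estimate over the coordinate directions.  This file provides the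
one-dimensional step and the calculus needed to iterate it:

* `fwdDiff_comm`, `fwdDiff_iterate_comm`, `fwdDiff_iterDiff` — the lattice derivatives commute;
* `iterDiff_add_single` — `∇^{α+e_i} = ∇_i ∇^α` (for `GradientFRD.iterDiff`);
* **`sq_le_line`** — for a segment `x₀, x₀+e_i, …, x₀+(ℓ−1)e_i` (`ℓ ≥ 1`) and any of its points `x`:
  `f(x)² ≤ 2ℓ⁻¹ Σ_{j<ℓ} f(x₀+je_i)² + 2ℓ Σ_{j<ℓ} (∇_i f(x₀+je_i))²`
  (telescoping + Cauchy–Schwarz; the `d = 1` case of Lemma 7.9 with `(ℓ∇)^α`, `α ∈ {0,1}`).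

Everything is proved; no named fact.  What is NOT here: the iteration over `d` directions
(Lemma 7.9 proper) and Lemma 7.8.

## References
* S. Adams, S. Buchholz, R. Kotecký, S. Müller, arXiv:1910.13564, Lemma 7.9 [AdamsBuchholzKoteckyMuller2019].
-/

noncomputable section

namespace Literature.MathematicalPhysics.StatisticalMechanics.GradientRG

open Finset
open Literature.MathematicalPhysics.StatisticalMechanics.GradientFRD (iterDiff)

/- `fwdDiff` below is `GradientFRD.fwdDiff` (Mathlib has an unrelated root `fwdDiff`). -/

variable {d M : ℕ}

/-! ## Lattice derivatives commute -/

/-- `∇_i ∇_j = ∇_j ∇_i`. [cite: AdamsBuchholzKoteckyMuller2019, App. A.5 (discrete derivatives)] -/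
theorem fwdDiff_comm (i j : Fin d) (f : (Fin d → ZMod M) → ℝ) :
    GradientFRD.fwdDiff i (GradientFRD.fwdDiff j f) = GradientFRD.fwdDiff j (GradientFRD.fwdDiff i f) := by
  funext x
  simp only [GradientFRD.fwdDiff]
  rw [add_right_comm]
  ring

/-- `∇_i ∇_j^{[n]} = ∇_j^{[n]} ∇_i`. [cite: AdamsBuchholzKoteckyMuller2019, App. A.5 (discrete derivatives)] -/
theorem fwdDiff_iterate_comm (i j : Fin d) (n : ℕ) (f : (Fin d → ZMod M) → ℝ) :
    GradientFRD.fwdDiff i ((GradientFRD.fwdDiff j)^[n] f) = (GradientFRD.fwdDiff j)^[n] (GradientFRD.fwdDiff i f) := by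
  have h : Function.Commute (GradientFRD.fwdDiff (M := M) i) (GradientFRD.fwdDiff j) := fun g => fwdDiff_comm i j g
  exact (h.iterate_right n f)

/-- `∇_i` commutes with the iterated gradient of any list of directions (plumbing). [folklore] -/
private theorem fwdDiff_foldr (i : Fin d) (α : Fin d → ℕ) (l : List (Fin d))
    (f : (Fin d → ZMod M) → ℝ) :
    GradientFRD.fwdDiff i (l.foldr (fun j g => (GradientFRD.fwdDiff j)^[α j] g) f) =
      l.foldr (fun j g => (GradientFRD.fwdDiff j)^[α j] g) (GradientFRD.fwdDiff i f) := by
  induction l with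
  | nil => rfl
  | cons j l ih => rw [List.foldr_cons, List.foldr_cons, fwdDiff_iterate_comm, ih]

/-- `∇_i ∇^α = ∇^α ∇_i`. [cite: AdamsBuchholzKoteckyMuller2019, App. A.5 (discrete derivatives)] -/
theorem fwdDiff_iterDiff (i : Fin d) (α : Fin d → ℕ) (f : (Fin d → ZMod M) → ℝ) :
    GradientFRD.fwdDiff i (iterDiff α f) = iterDiff α (GradientFRD.fwdDiff i f) :=
  fwdDiff_foldr i α (List.finRange d) f

/-- **`∇^{α + e_i} = ∇_i ∇^α`.** [cite: AdamsBuchholzKoteckyMuller2019, App. A.5 (discrete derivatives)] -/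
theorem iterDiff_add_single (α : Fin d → ℕ) (i : Fin d) (f : (Fin d → ZMod M) → ℝ) :
    iterDiff (α + Pi.single i 1) f = GradientFRD.fwdDiff i (iterDiff α f) := by
  -- over a duplicate-free list `l`: the extra `∇_i` appears iff `i ∈ l`
  have key : ∀ l : List (Fin d), l.Nodup →
      l.foldr (fun j g => (GradientFRD.fwdDiff j)^[(α + Pi.single i 1 : Fin d → ℕ) j] g) f =
        if i ∈ l then GradientFRD.fwdDiff i (l.foldr (fun j g => (GradientFRD.fwdDiff j)^[α j] g) f)
        else l.foldr (fun j g => (GradientFRD.fwdDiff j)^[α j] g) f := by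
    intro l
    induction l with
    | nil => intro _; simp
    | cons j l ih =>
      intro hnd
      rw [List.nodup_cons] at hnd
      rw [List.foldr_cons, List.foldr_cons, ih hnd.2]
      by_cases hji : j = i
      · subst hji
        have hnot : j ∉ l := hnd.1
        rw [if_neg hnot, if_pos (List.mem_cons_self ..), Pi.add_apply, Pi.single_eq_same,
          Function.iterate_succ_apply']
      · rw [Pi.add_apply, Pi.single_eq_of_ne hji, add_zero]
        by_cases hi : i ∈ l
        · rw [if_pos hi, if_pos (List.mem_cons_of_mem j hi), fwdDiff_iterate_comm]
        · rw [if_neg hi, if_neg (by simp [hi, Ne.symm hji])]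
  have h := key (List.finRange d) (List.nodup_finRange d)
  rw [if_pos (List.mem_finRange i)] at h
  exact h

/-! ## The one-dimensional discrete Sobolev inequality -/

/-- Points of the segment: `x₀ + j e_i`. [cite: AdamsBuchholzKoteckyMuller2019, Lemma 7.9] -/
theorem segment_succ (x₀ : Fin d → ZMod M) (i : Fin d) (j : ℕ) :
    x₀ + Pi.single i (((j + 1 : ℕ) : ZMod M)) = x₀ + Pi.single i ((j : ℕ) : ZMod M) + Pi.single i 1 := by
  rw [add_assoc, ← Pi.single_add, Nat.cast_succ]

/-- **Telescoping along a segment**: `f(x₀ + j₂e_i) − f(x₀ + j₁e_i) = Σ_{j₁ ≤ m < j₂} ∇_i f(x₀ + me_i)`.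
[cite: AdamsBuchholzKoteckyMuller2019, Lemma 7.9] -/
theorem sub_eq_sum_fwdDiff (f : (Fin d → ZMod M) → ℝ) (x₀ : Fin d → ZMod M) (i : Fin d) {j₁ j₂ : ℕ}
    (h : j₁ ≤ j₂) :
    f (x₀ + Pi.single i ((j₂ : ℕ) : ZMod M)) - f (x₀ + Pi.single i ((j₁ : ℕ) : ZMod M)) =
      ∑ m ∈ Ico j₁ j₂, GradientFRD.fwdDiff i f (x₀ + Pi.single i ((m : ℕ) : ZMod M)) := by
  have htel := Finset.sum_range_sub (fun m => f (x₀ + Pi.single i (((j₁ + m : ℕ)) : ZMod M))) (j₂ - j₁)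
  rw [show j₁ + (j₂ - j₁) = j₂ by omega, Nat.add_zero] at htel
  rw [← htel, Finset.sum_Ico_eq_sum_range]
  refine sum_congr rfl fun m _ => ?_
  rw [GradientFRD.fwdDiff, show j₁ + (m + 1) = j₁ + m + 1 by ring, segment_succ]

/-- `|f(x₀ + j₀e_i)| ≤ |f(x₀ + je_i)| + Σ_{m<ℓ} |∇_i f(x₀ + me_i)|` for `j, j₀ < ℓ`.
[cite: AdamsBuchholzKoteckyMuller2019, Lemma 7.9] -/
theorem abs_le_abs_add_sum (f : (Fin d → ZMod M) → ℝ) (x₀ : Fin d → ZMod M) (i : Fin d) {ℓ j j₀ : ℕ}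
    (hj : j < ℓ) (hj₀ : j₀ < ℓ) :
    |f (x₀ + Pi.single i ((j₀ : ℕ) : ZMod M))| ≤ |f (x₀ + Pi.single i ((j : ℕ) : ZMod M))| +
      ∑ m ∈ range ℓ, |GradientFRD.fwdDiff i f (x₀ + Pi.single i ((m : ℕ) : ZMod M))| := by
  have hsub : ∀ {a b : ℕ}, a ≤ b → b < ℓ →
      |f (x₀ + Pi.single i ((b : ℕ) : ZMod M)) - f (x₀ + Pi.single i ((a : ℕ) : ZMod M))| ≤
        ∑ m ∈ range ℓ, |GradientFRD.fwdDiff i f (x₀ + Pi.single i ((m : ℕ) : ZMod M))| := by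
    intro a b hab hb
    rw [sub_eq_sum_fwdDiff f x₀ i hab]
    refine (abs_sum_le_sum_abs _ _).trans ?_
    exact sum_le_sum_of_subset_of_nonneg (fun m hm => by
      rw [mem_Ico] at hm; rw [mem_range]; omega) fun _ _ _ => abs_nonneg _
  rcases le_or_gt j j₀ with h | h
  · have := hsub h hj₀
    have htri := abs_sub_abs_le_abs_sub (f (x₀ + Pi.single i ((j₀ : ℕ) : ZMod M)))
      (f (x₀ + Pi.single i ((j : ℕ) : ZMod M)))
    linarith
  · have := hsub h.le hj
    have htri := abs_sub_abs_le_abs_sub (f (x₀ + Pi.single i ((j₀ : ℕ) : ZMod M)))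
      (f (x₀ + Pi.single i ((j : ℕ) : ZMod M)))
    rw [abs_sub_comm] at this
    linarith

/-- **One-dimensional discrete Sobolev inequality** (the `d = 1` step of [ABKM19] Lemma 7.9, mixed
form): for `ℓ ≥ 1`, a segment `x₀ + je_i` (`j < ℓ`) and any of its points `x₀ + j₀e_i`,
`f(x₀+j₀e_i)² ≤ 2ℓ⁻¹ Σ_{j<ℓ} f(x₀+je_i)² + 2ℓ Σ_{j<ℓ} (∇_i f(x₀+je_i))²`.
[cite: AdamsBuchholzKoteckyMuller2019, Lemma 7.9] -/
theorem sq_le_line (f : (Fin d → ZMod M) → ℝ) (x₀ : Fin d → ZMod M) (i : Fin d) {ℓ j₀ : ℕ}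
    (hj₀ : j₀ < ℓ) :
    f (x₀ + Pi.single i ((j₀ : ℕ) : ZMod M)) ^ 2 ≤
      2 * (ℓ : ℝ)⁻¹ * ∑ j ∈ range ℓ, f (x₀ + Pi.single i ((j : ℕ) : ZMod M)) ^ 2 +
        2 * (ℓ : ℝ) * ∑ j ∈ range ℓ, (GradientFRD.fwdDiff i f (x₀ + Pi.single i ((j : ℕ) : ZMod M))) ^ 2 := by
  set a : ℕ → ℝ := fun j => |f (x₀ + Pi.single i ((j : ℕ) : ZMod M))| with ha
  set b : ℕ → ℝ := fun m => |GradientFRD.fwdDiff i f (x₀ + Pi.single i ((m : ℕ) : ZMod M))| with hb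
  have hℓ : (0 : ℝ) < ℓ := by exact_mod_cast (show 0 < ℓ by omega)
  set A := ∑ j ∈ range ℓ, a j with hA
  set Bs := ∑ m ∈ range ℓ, b m with hBs
  -- average the pointwise bound over `j < ℓ`: `ℓ |f(x)| ≤ A + ℓ Bs`
  have hpt : ∀ j ∈ range ℓ, a j₀ ≤ a j + Bs := fun j hj =>
    abs_le_abs_add_sum f x₀ i (mem_range.1 hj) hj₀
  have havg : (ℓ : ℝ) * a j₀ ≤ A + ℓ * Bs := by
    have := sum_le_sum hpt
    rw [sum_const, card_range, nsmul_eq_mul, sum_add_distrib, sum_const, card_range, nsmul_eq_mul] at this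
    linarith
  -- Cauchy–Schwarz: `A² ≤ ℓ Σ a², Bs² ≤ ℓ Σ b²`
  have hA2 : A ^ 2 ≤ ℓ * ∑ j ∈ range ℓ, a j ^ 2 := by
    have := sq_sum_le_card_mul_sum_sq (s := range ℓ) (f := a)
    rwa [card_range] at this
  have hB2 : Bs ^ 2 ≤ ℓ * ∑ m ∈ range ℓ, b m ^ 2 := by
    have := sq_sum_le_card_mul_sum_sq (s := range ℓ) (f := b)
    rwa [card_range] at this
  have ha2 : ∀ j, a j ^ 2 = f (x₀ + Pi.single i ((j : ℕ) : ZMod M)) ^ 2 := fun j => sq_abs _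
  have hb2 : ∀ m, b m ^ 2 = (GradientFRD.fwdDiff i f (x₀ + Pi.single i ((m : ℕ) : ZMod M))) ^ 2 := fun m => sq_abs _
  simp only [ha2] at hA2
  simp only [hb2] at hB2
  rw [← ha2 j₀]
  -- `(ℓ a)² ≤ (A + ℓ Bs)² ≤ 2A² + 2ℓ²Bs² ≤ 2ℓ Σa² + 2ℓ³ Σ b²`, divide by `ℓ²`
  have h0 : 0 ≤ a j₀ := abs_nonneg _
  have hA0 : 0 ≤ A := sum_nonneg fun j _ => abs_nonneg _
  have hBs0 : 0 ≤ Bs := sum_nonneg fun j _ => abs_nonneg _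
  have h1 : ((ℓ : ℝ) * a j₀) ^ 2 ≤ (A + ℓ * Bs) ^ 2 := pow_le_pow_left₀ (by positivity) havg 2
  have h2 : (A + ℓ * Bs) ^ 2 ≤ 2 * A ^ 2 + 2 * (ℓ * Bs) ^ 2 := by nlinarith [sq_nonneg (A - ℓ * Bs)]
  set S1 := ∑ j ∈ range ℓ, f (x₀ + Pi.single i ((j : ℕ) : ZMod M)) ^ 2 with hS1
  set S2 := ∑ j ∈ range ℓ, (GradientFRD.fwdDiff i f (x₀ + Pi.single i ((j : ℕ) : ZMod M))) ^ 2 with hS2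
  have hS1n : 0 ≤ S1 := sum_nonneg fun _ _ => sq_nonneg _
  have hS2n : 0 ≤ S2 := sum_nonneg fun _ _ => sq_nonneg _
  have h3 : (ℓ : ℝ) ^ 2 * a j₀ ^ 2 ≤ 2 * (ℓ * S1) + 2 * (ℓ ^ 2 * (ℓ * S2)) := by
    have : ((ℓ : ℝ) * a j₀) ^ 2 = (ℓ : ℝ) ^ 2 * a j₀ ^ 2 := by ring
    nlinarith [h1, h2, hA2, hB2]
  -- divide by `ℓ²`
  have hℓ2 : (0 : ℝ) < (ℓ : ℝ) ^ 2 := by positivity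
  have h4 : a j₀ ^ 2 ≤ (2 * (ℓ * S1) + 2 * (ℓ ^ 2 * (ℓ * S2))) / (ℓ : ℝ) ^ 2 := by
    rw [le_div_iff₀ hℓ2]; linarith
  refine h4.trans (le_of_eq ?_)
  field_simp

end Literature.MathematicalPhysics.StatisticalMechanics.GradientRG

end
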